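import Summits.BirchSwinnertonDyer.BirchSwinnertonDyer.Theorems.UniversalToricDescentKernelRationalRoadSqueeze
import HarnessLib

/-!
# Route `UniversalToricDescent` — the RATIONAL road's kernel with the twin's algebraic `μ = 0` asked ONLY AT ODD `d_K`
# (part 1/2: the pointwise kernel): towards kernel_rat⁺ `ToricKernelAtThreeApZeroOddRationalTwinMuOfPrint` (24256) under
# the restate candidates R1/R2 of `TwinAlgMuZeroAtThree` (24254)

Width prover `bsd-wall-utd-p1-w2` g6 under LEAD `bsd-wall-utd-p1` (g19 wrote the rational road's kernel p708172/p708518 with a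
twin hypothesis `hTμ` in the LIVE shape of 24254 — all Heegner `K`, no `Odd (discr K)`). The pen's self-audit (08:55Z) found that
shape engine-less at even `d_K`; director (367)/(368) scheduled a 1:1 restate R1 (`Odd (discr K)` added) or R2 (R1 restricted to the
kernel's twin buckets: multiplicative très ramifié ∨ good supersingular `a₃ = 0`) for the next generation, «R2 once a LEAD
kernel-confirms the bucket restriction». THIS PAIR OF FILES IS THAT CONFIRMATION, kernel-checked: part 1 (here) re-runs the
pointwise kernel with `hTμ'` asked only at odd `d_K` (and handed `W`'s datum `Dt` and the Heegner hypothesis for `N(W)`,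
both in the proof's hands: three tokens move); part 2 (`…KernelRationalRoadOddMuOfR2`) re-runs the trichotomy and the package level with the
R2 TEXT VERBATIM in place of `hTμ` — the good-ordinary bucket being supplied from the kernel's own binders
(`YanZhuMainConjectureInput`, `TwinMuZeroAtThree`) by `…TwinAlgMu.twinAlgMu_of_goodOrd_of_yanZhu_of_twinMuZero`.

* `bsdp_three_of_twinDegreeFrameAt_odd_of_sigma_of_ratwall_oddMu` — §2 of p708172 VERBATIM with `Dt`, `hHN`, `hodd` threaded to `hTμ'`.

THEOREMS ONLY; no definition, no named fact, no `sorry`; `--supports stmt-BirchSwinnertonDyer-24256`. HONEST FRAMING: an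
implication between route items and displayed hypotheses; BSD is proved for no curve by this file. References:
[GreenbergVatsal2000] Thm. (1.4), Prop. (2.8); [JetchevSkinnerWan2017] §7.4.1; [FriedbergHoffstein1995] Thm. B.
-/

noncomputable section

open scoped Classical

set_option linter.dupNamespace false
set_option autoImplicit false

namespace Summit.BirchSwinnertonDyer.BirchSwinnertonDyer.Theorems.UniversalToricDescentKernelRationalRoadOdd

open WeierstrassCurve NumberField IsDedekindDomain Field
  Literature.NumberTheory.EllipticCurves
  Literature.NumberTheory.EllipticCurves.ModularForms
  Literature.NumberTheory.EllipticCurves.Rank1Residual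
  Literature.NumberTheory.EllipticCurves.KrizLi2019
  Literature.NumberTheory.EllipticCurves.LiuZhangZhang2018
  Summit.BirchSwinnertonDyer.Rank1Residual
  Summit.BirchSwinnertonDyer.Rank1Residual.Additive
  Summit.BirchSwinnertonDyer.Rank1Residual.X11b
  Summit.BirchSwinnertonDyer.Rank1Residual.X11b.AcSelmer
  Summit.BirchSwinnertonDyer.Rank1Residual.X11b.Halves
  Summit.BirchSwinnertonDyer.BirchSwinnertonDyer.Theses.UniversalToricDescent
  Summit.BirchSwinnertonDyer.BirchSwinnertonDyer.Theorems
  Summit.BirchSwinnertonDyer.BirchSwinnertonDyer.Theorems.UniversalToricDescentTwinChoice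
  Summit.BirchSwinnertonDyer.BirchSwinnertonDyer.Theorems.UniversalToricDescentWaldspurgerFlat
  Summit.BirchSwinnertonDyer.BirchSwinnertonDyer.Theorems.UniversalToricDescentKernelOdd
  Summit.BirchSwinnertonDyer.BirchSwinnertonDyer.Theorems.UniversalToricDescentKernelOfPrint
  Summit.BirchSwinnertonDyer.BirchSwinnertonDyer.Theorems.UniversalToricDescentKernelFlatOfPrint
  Summit.BirchSwinnertonDyer.BirchSwinnertonDyer.Theorems.UniversalToricDescentActDFlatGlue
  Summit.BirchSwinnertonDyer.BirchSwinnertonDyer.Theorems.UniversalToricDescentNormProfile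
  Summit.BirchSwinnertonDyer.BirchSwinnertonDyer.Theorems.UniversalToricDescentDefectTransport
  Summit.BirchSwinnertonDyer.BirchSwinnertonDyer.Theorems.UniversalToricDescentDefectPTSqueeze
  Summit.BirchSwinnertonDyer.BirchSwinnertonDyer.Theorems.UniversalToricDescentKernelDefectPTOfPrint
  Summit.BirchSwinnertonDyer.BirchSwinnertonDyer.Theorems.UniversalToricDescentKernelDefectPTTROfPrint
  Summit.BirchSwinnertonDyer.BirchSwinnertonDyer.Theorems.UniversalToricDescentKernelDegreeOnlyTwin
  Summit.BirchSwinnertonDyer.BirchSwinnertonDyer.Theorems.UniversalToricDescentKernelDegreeOnlyTwinOfPrint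
  Summit.BirchSwinnertonDyer.BirchSwinnertonDyer.Cruxes.ToricTransportModThree
  Summit.BirchSwinnertonDyer.BirchSwinnertonDyer.Theorems.UniversalToricDescentKernelRationalRoad

/-- **Pointwise kernel of the RATIONAL road, twin algebraic `μ = 0` asked only at ODD `d_K`** =
`…KernelRationalRoad.bsdp_three_of_twinDegreeFrameAt_odd_of_sigma_of_ratwall` (LEAD utd-p1 g19, p708172) VERBATIM except that the
pointwise twin hypothesis `hTμ'` carries the extra binders `Odd (NumberField.discr K) →` (the shape of the restate candidates R1/R2
of `TwinAlgMuZeroAtThree` 24254; pen pss3x g8, director (367)/(368)) and — so that the good-ordinary bucket can be fed from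
`TwinMuZeroAtThree`, whose binders include the WILD curve's datum — a modular parametrisation of `W` and the Heegner hypothesis of
`K` for `N(W)`. Costs nothing: the kernel instantiates `hTμ'` only at the Friedberg–Hoffstein field it chooses (Heegner for `N(W)`
and `2N(W′)`, so `d_K` odd), with the datum `Dt` of `W` in hand.
CONDITIONAL on every displayed hypothesis; BSD is proved for no curve by this.
[cite: JetchevSkinnerWan2017, §7.4.1] [cite: FriedbergHoffstein1995, Thm. B] [cite: GreenbergVatsal2000, Thm. (1.4), Prop. (2.8)] -/
theorem bsdp_three_of_twinDegreeFrameAt_odd_of_sigma_of_ratwall_oddMu (hF : ToricPublishedInputs)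
    (hA : SigmaCongruenceAtThree) (hrat : RationalSplitIMCInclusionAtThree) (hmu : TwinMuZeroAtThree)
    (hPT : PoitouTateSelmerStructureDualityFact)
    (hV : ∀ (W : WeierstrassCurve ℚ) [W.IsElliptic] [W.IsGloballyMinimal] (N : ℕ) [NeZero N] (K : Type)
      [Field K] [NumberField K] (Dt : ModularParametrizationData W N) (H : HeegnerDatum N (NumberField.discr K))
      (ι : K →+* ℂ) (P : (W.baseChange K).toAffine.Point),
      Additive.ClassO6 W 3 → W.HasSurjectiveModNGaloisRep 3 → W.analyticRank = 1 → W.conductorNorm ℤ = N →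
      IsImaginaryQuadratic K → SatisfiesHeegnerHypothesis N K → Odd (NumberField.discr K) →
      (W.quadraticTwist (NumberField.discr K : ℚ)).entireLFunction 1 ≠ 0 →
      (WeierstrassCurve.Affine.Point.map ι.toRatAlgHom) P = heegnerPointComplex Dt H → ¬ IsOfFinAddOrder P →
      ∀ (κ : ZpExtension K 3), κ.IsAnticyclotomic → ∀ (γ : absoluteGaloisGroup K) [Fact (κ.IsTopGenerator γ)]
        (𝔭 : HeightOneSpectrum (𝓞 K)) (h𝔭 : ((3 : ℕ) : 𝓞 K) ∈ 𝔭.asIdeal)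
        (he : 𝔭.asIdeal.ramificationIdx (𝓞 ℚ) = 1) (hf : 𝔭.asIdeal.inertiaDeg (𝓞 ℚ) = 1),
        ∃ ι' : PadicAlgCl 3 ≃+* ℂ, SchneiderFree.BranchInducesPrime 3 ι' 𝔭 ∧
          ∃ (ΩK : ℂ) (Ωp : ℂ_[3]) (L : UnrSeries 3), ΩK ≠ 0 ∧ Ωp ≠ 0 ∧ IsBDPLFunction ι' 𝔭 κ γ Dt.f ΩK Ωp L ∧
            ∃ u : (unrIntegers 3)ˣ, L.HasValueAt 0 ((((u : unrIntegers 3) : unrIntegers 3) : ℂ_[3]) *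
              (algebraMap ℚ_[3] ℂ_[3] (logOmega W 3 (embAt K 3 𝔭 h𝔭 he hf) P / (Dt.c : ℚ_[3]))) ^ 2))
    (hC : WildSplitControlAtThree) (hZ : WildRankZeroTwistAtThree)
    (W : WeierstrassCurve ℚ) [W.IsElliptic] [W.IsGloballyMinimal]
    (hO6 : Additive.ClassO6 W 3) (hr : W.analyticRank = 1) (hsurj : W.HasSurjectiveModNGaloisRep 3)
    (W' : WeierstrassCurve ℚ) [W'.IsElliptic] [W'.IsGloballyMinimal]
    (hcong : O6.ModPCongruent W' W 3) (hW'ss : ¬ Addv W' 3)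
    (hI' : ∀ (N' : ℕ) [NeZero N'] (K : Type) [Field K] [NumberField K]
      (Dt' : ModularParametrizationData W' N'), W'.conductorNorm ℤ = N' → IsImaginaryQuadratic K →
      SatisfiesHeegnerHypothesis N' K → Odd (NumberField.discr K) →
      ∀ (κ : ZpExtension K 3), κ.IsAnticyclotomic →
      ∀ (γ : absoluteGaloisGroup K) [Fact (κ.IsTopGenerator γ)] (𝔭 : HeightOneSpectrum (𝓞 K)),
        ((3 : ℕ) : 𝓞 K) ∈ 𝔭.asIdeal → 𝔭.asIdeal.ramificationIdx (𝓞 ℚ) = 1 →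
        𝔭.asIdeal.inertiaDeg (𝓞 ℚ) = 1 →
      ∀ (𝔭' : HeightOneSpectrum (𝓞 K)), ((3 : ℕ) : 𝓞 K) ∈ 𝔭'.asIdeal → 𝔭' ≠ 𝔭 →
      ∀ (ι' : PadicAlgCl 3 ≃+* ℂ), SchneiderFree.BranchInducesPrime 3 ι' 𝔭 →
        ∃ (ΩK : ℂ) (Ωp : ℂ_[3]) (L' : UnrSeries 3), ΩK ≠ 0 ∧ Ωp ≠ 0 ∧
          IsBDPLFunction ι' 𝔭 κ γ Dt'.f ΩK Ωp L' ∧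
          (Module.IsTorsion (IwasawaAlgebra 3) (XAc (W'.baseChange K) 3 κ 𝔭' ∅ γ) →
            ∀ (g : UnrSeries 3) (n m : ℕ),
              (XAc.charIdeal (W'.baseChange K) 3 κ 𝔭' ∅ γ).map (PowerSeries.map (toUnr 3)) = Ideal.span {g} →
              (∀ i < n, ‖((PowerSeries.coeff i g : unrIntegers 3) : ℂ_[3])‖ < 1) ∧
                  ‖((PowerSeries.coeff n g : unrIntegers 3) : ℂ_[3])‖ = 1 →
              (∀ i < m, ‖((PowerSeries.coeff i L' : unrIntegers 3) : ℂ_[3])‖ < 1) ∧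
                  ‖((PowerSeries.coeff m L' : unrIntegers 3) : ℂ_[3])‖ = 1 →
              m ≤ n))
    (hTμ' : ∀ (N N' : ℕ) [NeZero N] [NeZero N'] (K : Type) [Field K] [NumberField K]
      (Dt : ModularParametrizationData W N) (Dt' : ModularParametrizationData W' N'),
      W.conductorNorm ℤ = N → W'.conductorNorm ℤ = N' → IsImaginaryQuadratic K → SatisfiesHeegnerHypothesis N K →
      SatisfiesHeegnerHypothesis N' K → Odd (NumberField.discr K) → ∀ (κ : ZpExtension K 3), κ.IsAnticyclotomic →
      ∀ (γ : absoluteGaloisGroup K) [Fact (κ.IsTopGenerator γ)] (𝔭 : HeightOneSpectrum (𝓞 K)),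
        ((3 : ℕ) : 𝓞 K) ∈ 𝔭.asIdeal → 𝔭.asIdeal.ramificationIdx (𝓞 ℚ) = 1 →
        𝔭.asIdeal.inertiaDeg (𝓞 ℚ) = 1 →
      ∀ (𝔭' : HeightOneSpectrum (𝓞 K)), ((3 : ℕ) : 𝓞 K) ∈ 𝔭'.asIdeal → 𝔭' ≠ 𝔭 →
        Module.IsTorsion (IwasawaAlgebra 3) (XAc (W'.baseChange K) 3 κ 𝔭' ∅ γ) ∧
          ∃ g' : UnrSeries 3, (XAc.charIdeal (W'.baseChange K) 3 κ 𝔭' ∅ γ).map (PowerSeries.map (toUnr 3)) =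
            Ideal.span {g'} ∧ ∃ i : ℕ, ‖((PowerSeries.coeff i g' : unrIntegers 3) : ℂ_[3])‖ = 1) :
    BSDp W 3 := by
  -- VERBATIM `…KernelRationalRoad.bsdp_three_of_twinDegreeFrameAt_odd_of_sigma_of_ratwall` (LEAD utd-p1 g19, p708172); the ONE change: `Dt`, `hHN`, `hodd` are passed to `hTμ'`
  obtain ⟨hGZ, hKo, hGZK, hmod, hmodP, -, hGZ73, hFH, hpar, hHP⟩ := hF
  haveI hN0 : NeZero (W.conductorNorm ℤ) := ⟨W.conductorNorm_pos_holds.ne'⟩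
  haveI hN0' : NeZero (W'.conductorNorm ℤ) := ⟨W'.conductorNorm_pos_holds.ne'⟩
  have hw : W.rootNumber = -1 := by
    rcases W.rootNumber_eq_one_or with h | h
    · exfalso
      have heven : Even W.analyticRank := (hpar W).mpr h
      rw [hr] at heven
      exact Nat.not_even_one heven
    · exact h
  obtain ⟨K, _, _, hK, -, hHN, hH2N', hLt⟩ :=
    hFH W hw (2 * W'.conductorNorm ℤ) (mul_ne_zero two_ne_zero hN0'.out) 0
  have hHN' : SatisfiesHeegnerHypothesis (W'.conductorNorm ℤ) K :=
    SatisfiesHeegnerHypothesis.of_dvd (dvd_mul_left _ 2) hH2N'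
  have hodd : Odd (NumberField.discr K) := by
    have h8 := Literature.SatisfiesHeegnerHypothesis.discr_emod_eight hK.1 hH2N' (dvd_mul_right 2 _)
    rw [Int.odd_iff]; omega
  have h3N : 3 ∣ W.conductorNorm ℤ :=
    (W.dvd_conductorNorm_iff_not_hasGoodReductionAtPrime 3).mpr (not_good_of_addv W 3 hO6.2.1)
  have hsplit : SplitsIn K 3 := hHN 3 Nat.prime_three h3N
  obtain ⟨P, Dt, H, ι, hP⟩ := hHP W K hK hHN
  have hL0 : W.entireLFunction 1 = 0 := entireLFunction_one_eq_zero_of_analyticRank_eq_one hr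
  obtain ⟨-, hderiv⟩ := leadingLCoeff_eq_deriv_of_analyticRank_eq_one hr
  have hLK : LDerivEK W K ≠ 0 := by
    rw [lDerivEK_eq_deriv_mul W K hmod hL0]; exact mul_ne_zero hderiv hLt
  have hnt : ¬ IsOfFinAddOrder P :=
    (lDerivEK_ne_zero_iff_not_isOfFinAddOrder W (W.conductorNorm ℤ) K (hGZ _ W K) hK hHN
      ⟨Dt, H, ι, hP⟩).mp hLK
  obtain ⟨hrk, hfin⟩ := hKo (W.conductorNorm ℤ) W K hK hHN ⟨Dt, H, ι, hP⟩ hnt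
  obtain ⟨Dt'⟩ := hmodP W'
  obtain ⟨κ, γ, -, hκ, hγ, -⟩ := X11b.exists_anticyclotomic_generator_prime (p := 3) hK
  haveI : Fact (κ.IsTopGenerator γ) := ⟨hγ⟩
  obtain ⟨𝔭, h𝔭, he, hf⟩ := X11b.exists_degreeOnePrime_of_splitsIn K 3 hK.1 hsplit
  obtain ⟨𝔭', hne, h𝔭', he', hf'⟩ := X11b.Three.exists_ne_degreeOne_prime hK.1 h𝔭 he hf
  obtain ⟨ι', hind, ΩK, Ωp, L, hΩK, hΩp, hBDP, u, hval⟩ :=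
    hV W (W.conductorNorm ℤ) K Dt H ι P hO6 hsurj hr rfl hK hHN hodd hLt hP hnt κ hκ γ 𝔭 h𝔭 he hf
  -- «deg»: the twin's frame with its TORSION-CONDITIONAL DEGREE clause
  have hdeg' := hI' (W'.conductorNorm ℤ) K Dt' rfl hK hHN' hodd κ hκ γ 𝔭 h𝔭 he hf 𝔭' h𝔭' hne ι' hind
  have hctl : SchneiderFree.AdditiveControlOnTreeAt 3 κ 𝔭' γ (embAt K 3 𝔭' h𝔭' he' hf') P :=
    hC W (W.conductorNorm ℤ) K Dt H ι P hO6 hsurj hr rfl hK hHN hLt hP hnt (hKo _ W K) κ hκ γ 𝔭'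
      h𝔭' he' hf'
  obtain ⟨n, hn, hneq⟩ := hctl
  -- «act E»: the wild curve's base finiteness at every `v ∋ 3`, from rank-one data over `K`
  have hfinE : ∀ (v : HeightOneSpectrum (𝓞 K)), ((3 : ℕ) : 𝓞 K) ∈ v.asIdeal →
      Finite (selmerAcBase (W.baseChange K) 3 v ∅) := by
    intro v hv
    haveI : Finite (W.baseChange K).sha := hfin
    have hSha3 : Finite (AddCommGroup.primaryComponent (W.baseChange K).sha 3) := inferInstance
    obtain ⟨he'', hf''⟩ := X11b.degreeOne_of_splitsIn hK.1 hsplit hv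
    obtain ⟨hfinv, -⟩ :=
      SchneiderFreeAdditiveX3.natCard_selmerAcBase_mul_eq_of_rankOne_anyTorsion_shaPrimary W 3 K (hPT K)
        (localEulerPoincareCharacteristicFact_proof K) hK hsplit hrk hSha3 P hnt v hv he'' hf''
    exact hfinv
  -- «rat»: A → rational wall → twin algebraic μ → μ squeeze in the DEGREE currency (§1): IMC EQUALITY for `E` at `L`
  have hTμi := hTμ' (W.conductorNorm ℤ) (W'.conductorNorm ℤ) K Dt Dt' rfl rfl hK hHN hHN' hodd κ hκ γ 𝔭 h𝔭 he hf 𝔭'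
    h𝔭' hne
  have heq : (XAc.charIdeal (W.baseChange K) 3 κ 𝔭' ∅ γ).map (PowerSeries.map (toUnr 3)) =
      Ideal.span {L} :=
    charIdeal_eq_of_sigma_of_ratwall_of_twinMu_degreeConditional W W' (W.conductorNorm ℤ) (W'.conductorNorm ℤ) K Dt Dt'
      hA hrat hmu hO6 hsurj hr rfl hcong hW'ss rfl hK hHN hHN' hfinE κ hκ γ 𝔭 h𝔭 he hf 𝔭' h𝔭' hne ι' hind
      hTμi hdeg' hΩK hΩp hBDP
  have hval' : L.HasValueAt 0 ((((u : unrIntegers 3) : unrIntegers 3) : ℂ_[3]) *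
      (algebraMap ℚ_[3] ℂ_[3]
        (logOmega W 3 (embAt K 3 𝔭' h𝔭' he' hf') P / (Dt.c : ℚ_[3]))) ^ 2) :=
    (SchneiderFreeAdditiveX3.hasValueAt_sq_logOmega_embAt_iff_of_rank_one W 3 hK.1 hrk h𝔭 he hf
      h𝔭' he' hf' P _ _ L).mpr hval
  have hc0 : Dt.c ≠ 0 := Dt.maninConstant_ne_zero_holds
  have hlog : logOmega W 3 (embAt K 3 𝔭' h𝔭' he' hf') P ≠ 0 := X11b.R1.logOmega_ne_zero W 3 _ hnt
  have hlow : SchneiderFree.AdditiveIMCLowerBDPOnTreeLeAt 3 κ 𝔭' γ (embAt K 3 𝔭' h𝔭' he' hf')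
      (padicValNat 3 Dt.c.natAbs) P := by
    obtain ⟨htors, f, hfI, hf0, hfn⟩ := hn
    have hmem : PowerSeries.map (toUnr 3) f ∈ Ideal.span {L} := by
      have h3 := heq.le
      rw [hfI, CongruenceLimit.map_span_singleton_powerSeries] at h3
      exact (Ideal.span_singleton_le_iff_mem _).mp h3
    obtain ⟨-, hle⟩ := Supersingular.two_mul_valuation_le_of_mem_span 3 hf0 hmem u hval'
    have hc0' : (Dt.c : ℚ_[3]) ≠ 0 := by exact_mod_cast hc0
    rw [div_eq_mul_inv, Padic.valuation_mul hlog (inv_ne_zero hc0'), Padic.valuation_inv,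
      Padic.valuation_intCast, valuation_logOmega hlog, hfn] at hle
    refine ⟨n, ⟨htors, f, hfI, hf0, hfn⟩, ?_⟩
    simp only [padicValInt] at hle
    linarith
  have hup : SchneiderFree.Upper.AdditiveIMCUpperBDPOnTreeLeAt 3 κ 𝔭' γ (embAt K 3 𝔭' h𝔭' he' hf')
      (padicValNat 3 Dt.c.natAbs) P :=
    SchneiderFree.Upper.additiveIMCUpperBDPOnTreeLeAt_of_value_of_dvd' hn heq.ge u hc0 hlog hval'
  have hlo : SchneiderFree.IndexLowerBoundLeAt W 3 K P (padicValNat 3 Dt.c.natAbs) :=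
    SchneiderFreeAdditiveX3.indexLowerBoundLeAt_of_imcLowerLe_of_control rfl hK hHN hfin hlow
      ⟨n, hn, hneq⟩
  have hupI : SchneiderFree.Upper.IndexUpperBoundLeAt W 3 K P (padicValNat 3 Dt.c.natAbs) :=
    SchneiderFree.Upper.indexUpperBoundLeAt_of_imcUpperLe_of_control rfl hK hHN hfin hup ⟨n, hn, hneq⟩
  have hD0 : (NumberField.discr K : ℚ) ≠ 0 := by exact_mod_cast NumberField.discr_ne_zero K
  haveI : (W.quadraticTwist (NumberField.discr K : ℚ)).IsElliptic := W.isElliptic_quadraticTwist hD0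
  obtain ⟨Cd, hCd⟩ := hasGlobalMinimalModel_rat_holds (W.quadraticTwist (NumberField.discr K : ℚ))
  haveI : (Cd • W.quadraticTwist (NumberField.discr K : ℚ)).IsGloballyMinimal := hCd
  exact SchneiderFree.Exact.bsdp_three_of_exactIndexManin_of_wAllExclAddWildRankZero hGZ hKo hGZK hmod
    hGZ73 hZ W hO6 hsurj hr (W.conductorNorm ℤ) K Dt H ι P
    (Cd • W.quadraticTwist (NumberField.discr K : ℚ)) rfl hK hodd hHN hLt hP ⟨Cd, rfl⟩ hlo hupI


end Summit.BirchSwinnertonDyer.BirchSwinnertonDyer.Theorems.UniversalToricDescentKernelRationalRoadOdd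

end
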